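import Summits.CriticalPhenomena.PercolationContinuityZ3.Theorems.PercNearOneGluingNoHeavyLowerTailSahiLatinBridge4
import Summits.CriticalPhenomena.PercolationContinuityZ3.Theorems.PercNearOneGluingNoHeavyLowerTailSahiPatternPosFour

/-!
# `NoHeavyLowerTail` (crux stmt-CriticalPhenomena-4575), Sahi programme (prim-master-conj gen 42): DICTIONARY between the `SahiLatin`
# development (R/A-descent, terminal triples, order-4 ladder) and the Sahi cell's PATTERN programme (`SahiGridPattern.PatternPos`,
# seat prim-sahi-p1 gen 7; `…SahiPairSaturation`, `…SahiPatternPosFour`, prim-sahi-typer gen 31–32)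

Support file (`--supports stmt-CriticalPhenomena-4575`; COMPUTATIONAL through `…SahiPatternPosFour`'s twenty `native_decide` chunks).

The Latin kernel `SahiLatin.kappa` on `[3]^ι` (`…SahiLatinKernel`, 2026-08-26) and the pattern functional `SahiGridPattern.sStarD` on
`[3]^d` (`…SahiGridPattern`, 2026-08-20) are THE SAME OBJECT (`kappa_eq_sStarD`: both are `Σ_{π : Fin d → Perm (Fin 3)} h(π·0, π·1, π·2)` with
Sahi's three-copy kernel `h`), so `LatinPos (Fin d) ↔ PatternPos d` (`latinPos_iff_patternPos`).  Consequences: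
* `patternPos_iff_terminalPos` — the all-`d` R/A-DESCENT THEOREM in the pattern programme's vocabulary: **`PatternPos d` holds iff `sStarD ≥ 0`
  on the TERMINAL up-set triples of `[3]^d`** ((C1) no minimal element of a member inside the other two, (C2) every maximal non-element of a
  member inside the other two; `SahiLatin.Terminal`).  (The pattern programme's own normal form is pair SATURATION, `…SahiPairSaturation`;
  terminal triples add the (C1)/R-move half: `16 491` terminal vs `76 924` saturated ordered triples of `[3]³`.)
* `latinPos_fin_four : LatinPos (Fin 4)` — FBP(3,4), i.e. the cell `(4,3)`, from the tree theorem `SahiGridPattern.patternPos_four`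
  (pair-saturation certificate, 2026-08-24) — so the `d = 4` enumeration of gen 41 (76 380 564 165 terminal triples, 0 negative) was an
  independent confirmation of a KERNEL theorem;
* **`latinPos4_fin_four_iff : LatinPos4 (Fin 4) ↔ TerminalPos4 (Fin 4)`** — the OPEN cell `(4,4)` (Sahi's `E₄` on products of four chains /
  Lieb–Sahi on `[0,1]^4` at order 4) is reduced in the kernel to terminal positivity of up-set 4-tuples of `[4]^4` (order-4 ladder
  `latinPos4_iff_terminalPos4` with its order-3 input now discharged), and `sahiPositive_four_pi_fin_four_of_terminalPos4`.
Everything here is proved; axioms standard (+ `Lean.ofReduceBool`/`Lean.trustCompiler` via the imported certificate).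
-/

namespace Summit.CriticalPhenomena.PercolationContinuityZ3.Theorems.SahiLatin

open Finset Literature.Combinatorics.Sahi2008

/-- **The Latin kernel IS the pattern functional**: `SahiLatin.kappa = SahiGridPattern.sStarD` on `[3]^d`. [this work] -/
theorem kappa_eq_sStarD {d : ℕ} (A B C : Finset (Pt (Fin d))) : kappa A B C = SahiGridPattern.sStarD A B C := by
  unfold kappa SahiGridPattern.sStarD
  refine sum_congr rfl fun π _ => ?_
  have hc : ∀ j, SahiGridPattern.col π j = lpt π j := fun _ => rfl
  have hi : ∀ (S : Finset (Pt (Fin d))) (x : Pt (Fin d)), SahiGrid3.ind S x = ind S x := fun _ _ => rfl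
  simp only [G, SahiGrid3.hZ, hc, hi]
  ring

/-- `LatinPos (Fin d) ↔ PatternPos d`. [this work] -/
theorem latinPos_iff_patternPos {d : ℕ} : LatinPos (Fin d) ↔ SahiGridPattern.PatternPos d := by
  constructor
  · intro h A B C hA hB hC
    rw [← kappa_eq_sStarD]
    exact h A B C ⟨hA, hB, hC⟩
  · intro h A B C hup
    rw [kappa_eq_sStarD]
    exact h A B C hup.1 hup.2.1 hup.2.2

/-- **The R/A-descent theorem for the pattern programme (all `d`)**: `PatternPos d` iff `sStarD ≥ 0` on the TERMINAL up-set triples of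
`[3]^d`. [this work] -/
theorem patternPos_iff_terminalPos {d : ℕ} : SahiGridPattern.PatternPos d ↔ TerminalPos (Fin d) :=
  latinPos_iff_patternPos.symm.trans latinPos_iff_terminalPos

/-- **FBP(3,4)** (`LatinPos (Fin 4)`, the cell `(4,3)`) — from the tree theorem `SahiGridPattern.patternPos_four`. [this work] -/
theorem latinPos_fin_four : LatinPos (Fin 4) := latinPos_iff_patternPos.2 SahiGridPattern.patternPos_four

/-- `LatinPos (Fin d)` for every `d ≤ 4`. [this work] -/
theorem latinPos_of_le_four {d : ℕ} (hd : d ≤ 4) : LatinPos (Fin d) :=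
  latinPos_iff_patternPos.2 (SahiGridPattern.patternPos_of_le_four hd)

/-- **The open cell `(4,4)` reduced**: FBP(4,4) ⟺ terminal positivity of up-set 4-tuples of `[4]^4`. [this work] -/
theorem latinPos4_fin_four_iff : LatinPos4 (Fin 4) ↔ TerminalPos4 (Fin 4) := latinPos4_iff_terminalPos4 latinPos_fin_four

/-- For every `d ≤ 4`: FBP(4,d) ⟺ terminal positivity of order 4 on `[4]^d`. [this work] -/
theorem latinPos4_iff_terminalPos4_of_le_four {d : ℕ} (hd : d ≤ 4) : LatinPos4 (Fin d) ↔ TerminalPos4 (Fin d) :=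
  latinPos4_iff_terminalPos4 (latinPos_of_le_four hd)

/-- **`E₄ ≥ 0` on every product of FOUR finite linear orders, every product probability weight, GIVEN terminal positivity of `[4]^4`**
(the finite residue of the open cell `(4,4)`). [this work] -/
theorem sahiPositive_four_pi_fin_four_of_terminalPos4 (hT : TerminalPos4 (Fin 4)) {α : Fin 4 → Type*} [∀ i, Fintype (α i)]
    [∀ i, LinearOrder (α i)] (w : ∀ i, α i → ℝ) (hw : ∀ i x, 0 ≤ w i x) (hw1 : ∀ i, ∑ x, w i x = 1) :
    SahiPositive (fun p : (∀ i, α i) => ∏ i, w i (p i)) 4 :=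
  sahiPositive_four_of_terminalPos4 latinPos_fin_four hT w hw hw1

end Summit.CriticalPhenomena.PercolationContinuityZ3.Theorems.SahiLatin
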